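/-
COR-CM (cell pub-hodgecm2) — Δ2 BRIDGE, X1 pin «J» (ASSEMBLER DECISIONS #3/#4, HOME/INBOX l.10797, l.10813: «the J1 reading is
ADOPTED as the pin's J-record of record»): THE RATIONAL FORM OF THE MODEL'S TOWER.  The pin's complex carrier
`T.H = Tower … V = colim_K H¹(X_K(ℂ); ℂ)` is built from rational pull-backs base-changed to `ℂ` (`pullC_transMorU`), so it HAS a
rational form `U = TowerQ … V` with an injective, equivariant complexification `ιT : ℂ ⊗_ℚ U →ₗ[ℂ] T.H` — the fields `U ∕ ι ∕ ι_injective`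
(here) and `ρU ∕ ι_comm` (part 2) of the proof's record `Map43RationalData` at the pin.  Seat prover-pub-hodgecm2-d2bridge-prove-3-g0-0.
Port-gated (Model cone); written blind during the L38 hole, checked at BURST-2 END.  HC_CM is NOT proved; no display ∕ pointer move.
-/
import Summits.HodgeConjecture.HodgeCM.Model.TowerRes
import Summits.HodgeConjecture.HodgeCM.Model.TowerAlgebra
import Summits.HodgeConjecture.CorCM.D2Bridge.RationalFormToolkit
import Mathlib.RingTheory.TensorProduct.Basic
import HarnessLib

/-!
# Δ2 bridge, pin J (J1): the rational form `TowerQ` of the model's tower and its complexification `ιT`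

Read off the tower files `HodgeCM/Model/TowerLevel_1∕_2`, `TowerCarrier`, `TowerRes`, `TowerInjective`, `TowerAlgebra`:
§1 `trPullQ` (the RATIONAL translate pull-back `U.pull (t_γ)`; `trPull_tmul`: the complex `trPull` IS its base change);
§2 `levelQ Γ hΓ : Submodule ℚ (Π h, H¹(P_{Γ_h}(ℂ); ℚ))` (families whose complexification `cplx` lies in `towerLevel Γ hΓ`;
`mem_levelQ_iff_rel`), `inclQ : levelQ →ₗ[ℚ] towerLevel` (injective), `restrictQ` (`inclQ ∘ restrictQ = restrictLevel ∘ inclQ`);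
§3 `TowerQ … V := Module.DirectLimit levelQ restrictQ` over `TLvl V`, `ofQ`, `ofQ_injective`;
§4 `ιT : ℂ ⊗_ℚ TowerQ →ₗ[ℂ] Tower` (`liftBaseChange` of the `ℚ`-linear `jQ`, `Tower` a `ℚ`-module by `Module.compHom` along `ℚ → ℂ`,
as `TowerAlgebra` does for `ℂ[U(V)(𝔸_f)]`), `ιT_tmul_ofQ`, **`ιT_injective`** (toolkit `piRightHom_injective_of_free`,
`baseChange_injective`, `exists_lTensor_of` + tree `ofLevel_injective`).  Part 2 (`TowerRationalFormEquivariant.lean`): `towerRepQ`,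
**`ιT_comm`**, `resQ` and the level law **`resTotal_ιT_tmul_ofQ`** (the S3 pin field `tower_eq`).  At the pin: `U := TowerQ`,
`ρU := towerRepQ`, `HB := Tower`, `ρB := towerRep`, `ι := ιT`, S₀'s `jH := LinearMap.id`, prove-2's `transKQ := ofQ`, `AKQ K := levelQ Γ_K`.
No named fact beyond the tower's parameters `hHD hI hU h₃ hA`; no `sorry`.
-/

noncomputable section

open scoped TensorProduct
open Function
open Literature.AlgebraicGeometry.Motives
open Literature.AlgebraicGeometry.HodgeTheory
open Literature.NumberTheory.Automorphic
open Literature.NumberTheory.Automorphic.PicardCM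
open Literature.NumberTheory.Transcendental (Arapura2012_Cor_15_4_6)
open HodgeCM HodgeCM.Model HodgeCM.Model.LevelTranslate HodgeCM.Model.TowerLevel HodgeCM.Model.TowerCarrier
open HodgeCM.Model.TowerInjective

namespace Summit.HodgeConjecture.CorCM.D2Bridge

namespace TowerRational

variable (hHD : exists_isReal_hodgeModel) (hI : hodgePQ_independent_of_hodgeModel)
  (hU : BallQuotientUniformisedDatum) (h₃ : CMAbelianVarietyRealised) (hA : Arapura2012_Cor_15_4_6)
variable {L : CMField} {ι₁ : L →+* ℂ} {V : HermSpace3 L ι₁}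

/-! ## §1 Rational coefficients at one component -/

/-- `Hᵏ(P_Δ(ℂ); ℚ) = U.Coh (U.pms L ι₁ V Δ) k` (the rational Betti cohomology of the component surface; its base change
`ℂ ⊗_ℚ –` is the tower's `TowerLevel.Coh … Δ k = U.CohC …`). [folklore] -/
abbrev CohQ (Δ : Level V) (k : ℕ) : Type :=
  (universeOf hHD hI hU h₃).Coh ((universeOf hHD hI hU h₃).pms L ι₁ V Δ) k

/-- **The rational translate pull-back** `t_γ^* : Hᵏ(P_{Δ₂}(ℂ); ℚ) → Hᵏ(P_{Δ₁}(ℂ); ℚ)` (`U.pull (t_γ)`; the tower's `trPull` is its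
base change to `ℂ`). [folklore] -/
abbrev trPullQ (γ : ↥(Urat V)) (Δ₁ Δ₂ : Level V) (ht : TransCond (γ : GL (Fin 3) L) Δ₁ Δ₂) (k : ℕ) :
    CohQ hHD hI hU h₃ Δ₂ k →ₗ[ℚ] CohQ hHD hI hU h₃ Δ₁ k :=
  (universeOf hHD hI hU h₃).pull (transMorU hU h₃ hHD hI hA γ.2 Δ₁ Δ₂ ht) k

/-- **`trPull (z ⊗ x) = z ⊗ trPullQ x`**: the complex translate pull-back is the base change of the rational one
(`pullC_transMorU`). [folklore] -/
theorem trPull_tmul (γ : ↥(Urat V)) (Δ₁ Δ₂ : Level V) (ht : TransCond (γ : GL (Fin 3) L) Δ₁ Δ₂) (k : ℕ) (z : ℂ)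
    (x : CohQ hHD hI hU h₃ Δ₂ k) :
    trPull hHD hI hU h₃ hA γ Δ₁ Δ₂ ht k (z ⊗ₜ[ℚ] x) = z ⊗ₜ[ℚ] trPullQ hHD hI hU h₃ hA γ Δ₁ Δ₂ ht k x := by
  show ((universeOf hHD hI hU h₃).pull (transMorU hU h₃ hHD hI hA γ.2 Δ₁ Δ₂ ht) k).baseChange ℂ (z ⊗ₜ[ℚ] x) = _
  rw [LinearMap.baseChange_tmul]

/-! ## §2 Rational families, the rational level `levelQ`, `inclQ`, `restrictQ`, `resQ` -/

section Level

variable (Γ : Level V) (hΓ : Γ.BelowConjThree)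

/-- `H¹(P_{Γ_h}(ℂ); ℚ)` of the component of index `h` (the rational form of `TowerLevel.W`). [folklore] -/
abbrev WQ (h : V.adelicFin) : Type := CohQ hHD hI hU h₃ (Γ.conj h hΓ) 1

/-- **Complexification of a rational family**: `(cplx c) h = 1 ⊗ c h`. [folklore] -/
def cplx : (Π h : V.adelicFin, WQ hHD hI hU h₃ Γ hΓ h) →ₗ[ℚ] (Π h : V.adelicFin, W hHD hI hU h₃ Γ hΓ h) where
  toFun c h := (1 : ℂ) ⊗ₜ[ℚ] c h
  map_add' c d := funext fun h => by
    show (1 : ℂ) ⊗ₜ[ℚ] (c h + d h) = (1 : ℂ) ⊗ₜ[ℚ] c h + (1 : ℂ) ⊗ₜ[ℚ] d h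
    rw [TensorProduct.tmul_add]
  map_smul' q c := funext fun h => by
    show (1 : ℂ) ⊗ₜ[ℚ] (q • c h) = q • ((1 : ℂ) ⊗ₜ[ℚ] c h)
    rw [TensorProduct.tmul_smul]

variable {Γ hΓ}

/-- Unfolding. [folklore] -/
@[simp] theorem cplx_apply (c : Π h : V.adelicFin, WQ hHD hI hU h₃ Γ hΓ h) (h : V.adelicFin) :
    cplx hHD hI hU h₃ Γ hΓ c h = (1 : ℂ) ⊗ₜ[ℚ] c h := rfl

/-- A rational family is determined by its complexification (`x ↦ 1 ⊗ x` is injective, `one_tmul_injective`). [folklore] -/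
theorem cplx_injective : Injective (cplx hHD hI hU h₃ Γ hΓ) := fun _ _ hcd =>
  funext fun h => TensorProduct.one_tmul_injective ℚ ℂ _ (congrFun hcd h)

/-- `ℂ`-multiples of a complexified family: `z • cplx c = (h ↦ z ⊗ c h)`. [folklore] -/
theorem smul_cplx_apply (z : ℂ) (c : Π h : V.adelicFin, WQ hHD hI hU h₃ Γ hΓ h) (h : V.adelicFin) :
    (z • cplx hHD hI hU h₃ Γ hΓ c) h = z ⊗ₜ[ℚ] c h := by
  rw [Pi.smul_apply, cplx_apply, TensorProduct.smul_tmul', smul_eq_mul, mul_one]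

variable (Γ hΓ)

/-- **The rational level `U_K ⊆ Π_h H¹(P_{Γ_h}(ℂ); ℚ)`**: the rational families whose complexification lies in the tower's level
`towerLevel Γ hΓ` (a `ℚ`-submodule: the comap of `cplx`). [folklore] -/
def levelQ : Submodule ℚ (Π h : V.adelicFin, WQ hHD hI hU h₃ Γ hΓ h) :=
  ((towerLevel hHD hI hU h₃ hA Γ hΓ).restrictScalars ℚ).comap (cplx hHD hI hU h₃ Γ hΓ)

variable {Γ hΓ}

/-- Membership: `c ∈ levelQ ↔ cplx c ∈ towerLevel`. [folklore] -/
theorem mem_levelQ_iff {c : Π h : V.adelicFin, WQ hHD hI hU h₃ Γ hΓ h} :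
    c ∈ levelQ hHD hI hU h₃ hA Γ hΓ ↔ cplx hHD hI hU h₃ Γ hΓ c ∈ towerLevel hHD hI hU h₃ hA Γ hΓ :=
  Iff.rfl

variable (Γ hΓ)

/-- **`inclQ : U_K → H_K`**, the inclusion of the rational level into the tower's level (`ℚ`-linear; the level `H_K` is a
`ℚ`-module by restriction of scalars inside `Π_h ℂ ⊗_ℚ H¹(P_{Γ_h}(ℂ); ℚ)`). [folklore] -/
def inclQ : levelQ hHD hI hU h₃ hA Γ hΓ →ₗ[ℚ] towerLevel hHD hI hU h₃ hA Γ hΓ where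
  toFun c := ⟨cplx hHD hI hU h₃ Γ hΓ (c : Π h : V.adelicFin, WQ hHD hI hU h₃ Γ hΓ h), c.2⟩
  map_add' _ _ := Subtype.ext (map_add (cplx hHD hI hU h₃ Γ hΓ) _ _)
  map_smul' _ _ := Subtype.ext (map_smul (cplx hHD hI hU h₃ Γ hΓ) _ _)

variable {Γ hΓ}

/-- Unfolding. [folklore] -/
@[simp] theorem coe_inclQ (c : levelQ hHD hI hU h₃ hA Γ hΓ) :
    (inclQ hHD hI hU h₃ hA Γ hΓ c : Π h : V.adelicFin, W hHD hI hU h₃ Γ hΓ h) =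
      cplx hHD hI hU h₃ Γ hΓ (c : Π h : V.adelicFin, WQ hHD hI hU h₃ Γ hΓ h) := rfl

/-- Unfolding, componentwise. [folklore] -/
theorem coe_inclQ_apply (c : levelQ hHD hI hU h₃ hA Γ hΓ) (h : V.adelicFin) :
    (inclQ hHD hI hU h₃ hA Γ hΓ c : Π h : V.adelicFin, W hHD hI hU h₃ Γ hΓ h) h =
      (1 : ℂ) ⊗ₜ[ℚ] (c : Π h : V.adelicFin, WQ hHD hI hU h₃ Γ hΓ h) h := rfl

/-- `inclQ` is injective. [folklore] -/
theorem inclQ_injective : Injective (inclQ hHD hI hU h₃ hA Γ hΓ) := fun _ _ e =>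
  Subtype.ext (cplx_injective hHD hI hU h₃ (congrArg Subtype.val e))

/-- `ℂ`-multiples of `inclQ c`, componentwise: `(z • inclQ c) h = z ⊗ c h`. [folklore] -/
theorem coe_smul_inclQ_apply (z : ℂ) (c : levelQ hHD hI hU h₃ hA Γ hΓ) (h : V.adelicFin) :
    ((z • inclQ hHD hI hU h₃ hA Γ hΓ c : towerLevel hHD hI hU h₃ hA Γ hΓ) : Π h : V.adelicFin, W hHD hI hU h₃ Γ hΓ h) h =
      z ⊗ₜ[ℚ] (c : Π h : V.adelicFin, WQ hHD hI hU h₃ Γ hΓ h) h := by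
  rw [Submodule.coe_smul, coe_inclQ, smul_cplx_apply]

/-- **`restrictQ : U_K → U_{K'}`** (`K' ≤ K`): componentwise rational pull-back along the coverings `P'_h ⟶ P_h` — the rational form of
`restrictLevel`. [folklore] -/
def restrictQ {Γ Γ' : Level V} (hle : Γ' ≤ Γ) (hΓ : Γ.BelowConjThree) (hΓ' : Γ'.BelowConjThree) :
    levelQ hHD hI hU h₃ hA Γ hΓ →ₗ[ℚ] levelQ hHD hI hU h₃ hA Γ' hΓ' where
  toFun c := ⟨fun h => trPullQ hHD hI hU h₃ hA 1 (Γ'.conj h hΓ') (Γ.conj h hΓ) (transCond_conj_of_le hle hΓ hΓ' h) 1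
      ((c : Π h : V.adelicFin, WQ hHD hI hU h₃ Γ hΓ h) h), by
    rw [mem_levelQ_iff]
    have e : cplx hHD hI hU h₃ Γ' hΓ' (fun h => trPullQ hHD hI hU h₃ hA 1 (Γ'.conj h hΓ') (Γ.conj h hΓ)
        (transCond_conj_of_le hle hΓ hΓ' h) 1 ((c : Π h : V.adelicFin, WQ hHD hI hU h₃ Γ hΓ h) h)) =
        (restrictLevel hHD hI hU h₃ hA hle hΓ hΓ' (inclQ hHD hI hU h₃ hA Γ hΓ c) :
          Π h : V.adelicFin, W hHD hI hU h₃ Γ' hΓ' h) := by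
      funext h
      rw [cplx_apply, restrictLevel_apply, coe_inclQ_apply, trPull_tmul]
    rw [e]
    exact (restrictLevel hHD hI hU h₃ hA hle hΓ hΓ' (inclQ hHD hI hU h₃ hA Γ hΓ c)).2⟩
  map_add' c d := by
    apply Subtype.ext
    funext h
    show trPullQ hHD hI hU h₃ hA 1 _ _ _ 1 (((c + d : levelQ hHD hI hU h₃ hA Γ hΓ) : Π h, WQ hHD hI hU h₃ Γ hΓ h) h) =
      trPullQ hHD hI hU h₃ hA 1 _ _ _ 1 ((c : Π h, WQ hHD hI hU h₃ Γ hΓ h) h) +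
        trPullQ hHD hI hU h₃ hA 1 _ _ _ 1 ((d : Π h, WQ hHD hI hU h₃ Γ hΓ h) h)
    rw [Submodule.coe_add, Pi.add_apply, map_add]
  map_smul' q c := by
    apply Subtype.ext
    funext h
    show trPullQ hHD hI hU h₃ hA 1 _ _ _ 1 (((q • c : levelQ hHD hI hU h₃ hA Γ hΓ) : Π h, WQ hHD hI hU h₃ Γ hΓ h) h) =
      q • trPullQ hHD hI hU h₃ hA 1 _ _ _ 1 ((c : Π h, WQ hHD hI hU h₃ Γ hΓ h) h)
    rw [Submodule.coe_smul, Pi.smul_apply, map_smul]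

/-- Unfolding, componentwise. [folklore] -/
theorem coe_restrictQ_apply {Γ Γ' : Level V} (hle : Γ' ≤ Γ) (hΓ : Γ.BelowConjThree) (hΓ' : Γ'.BelowConjThree)
    (c : levelQ hHD hI hU h₃ hA Γ hΓ) (h : V.adelicFin) :
    (restrictQ hHD hI hU h₃ hA hle hΓ hΓ' c : Π h : V.adelicFin, WQ hHD hI hU h₃ Γ' hΓ' h) h =
      trPullQ hHD hI hU h₃ hA 1 (Γ'.conj h hΓ') (Γ.conj h hΓ) (transCond_conj_of_le hle hΓ hΓ' h) 1
        ((c : Π h : V.adelicFin, WQ hHD hI hU h₃ Γ hΓ h) h) := rfl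

/-- **`inclQ ∘ restrictQ = restrictLevel ∘ inclQ`**: the rational change of level complexifies to the tower's. [folklore] -/
theorem inclQ_restrictQ {Γ Γ' : Level V} (hle : Γ' ≤ Γ) (hΓ : Γ.BelowConjThree) (hΓ' : Γ'.BelowConjThree)
    (c : levelQ hHD hI hU h₃ hA Γ hΓ) :
    inclQ hHD hI hU h₃ hA Γ' hΓ' (restrictQ hHD hI hU h₃ hA hle hΓ hΓ' c) =
      restrictLevel hHD hI hU h₃ hA hle hΓ hΓ' (inclQ hHD hI hU h₃ hA Γ hΓ c) := by
  apply Subtype.ext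
  funext h
  rw [coe_inclQ_apply, coe_restrictQ_apply, restrictLevel_apply, coe_inclQ_apply, trPull_tmul]

/-- `restrictQ` is injective (`restrictLevel_injective` read rationally). [folklore] -/
theorem restrictQ_injective {Γ Γ' : Level V} (hle : Γ' ≤ Γ) (hΓ : Γ.BelowConjThree) (hΓ' : Γ'.BelowConjThree) :
    Injective (restrictQ hHD hI hU h₃ hA hle hΓ hΓ') := fun _ _ e =>
  inclQ_injective hHD hI hU h₃ hA (restrictLevel_injective hHD hI hU h₃ hA hle hΓ hΓ' (by
    rw [← inclQ_restrictQ, ← inclQ_restrictQ, e]))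

/-- `restrictQ` at `Γ' = Γ` is the identity. [folklore] -/
theorem restrictQ_refl {Γ : Level V} (hΓ : Γ.BelowConjThree) (c : levelQ hHD hI hU h₃ hA Γ hΓ) :
    restrictQ hHD hI hU h₃ hA (le_refl Γ) hΓ hΓ c = c :=
  inclQ_injective hHD hI hU h₃ hA (by rw [inclQ_restrictQ, restrictLevel_refl])

/-- `restrictQ` is transitive. [folklore] -/
theorem restrictQ_trans {Γ Γ' Γ'' : Level V} (hle : Γ' ≤ Γ) (hle' : Γ'' ≤ Γ') (hΓ : Γ.BelowConjThree)
    (hΓ' : Γ'.BelowConjThree) (hΓ'' : Γ''.BelowConjThree) (c : levelQ hHD hI hU h₃ hA Γ hΓ) :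
    restrictQ hHD hI hU h₃ hA hle' hΓ' hΓ'' (restrictQ hHD hI hU h₃ hA hle hΓ hΓ' c) =
      restrictQ hHD hI hU h₃ hA (hle'.trans hle) hΓ hΓ'' c :=
  inclQ_injective hHD hI hU h₃ hA (by rw [inclQ_restrictQ, inclQ_restrictQ, inclQ_restrictQ, restrictLevel_trans])

end Level

/-! ## §3 The rational tower `TowerQ = colim_K U_K` -/

section Colimit

variable (V)

/-- `U_{K_i}` at the index `i`. [folklore] -/
abbrev HKQ (i : TLvl V) : Type := ↥(levelQ hHD hI hU h₃ hA i.1 i.2)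

/-- The transition maps of the rational tower (`restrictQ`). [folklore] -/
def systemQ (i j : TLvl V) (hij : i ≤ j) : HKQ hHD hI hU h₃ hA V i →ₗ[ℚ] HKQ hHD hI hU h₃ hA V j :=
  restrictQ hHD hI hU h₃ hA (TLvl.le_def.mp hij) i.2 j.2

/-- The rational tower is a directed system (from `restrictQ_refl ∕ _trans`). [folklore] -/
instance directedSystemQ : DirectedSystem (HKQ hHD hI hU h₃ hA V) (fun i j hij => systemQ hHD hI hU h₃ hA V i j hij) where
  map_self i x := restrictQ_refl hHD hI hU h₃ hA i.2 x
  map_map k j i hij hjk x := restrictQ_trans hHD hI hU h₃ hA (TLvl.le_def.mp hij) (TLvl.le_def.mp hjk) i.2 j.2 k.2 x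

/-- **The rational tower `U = colim_K H¹(X_K(ℂ); ℚ)`** of `(L, ι₁, V)`: the direct limit of the rational levels along `restrictQ`,
over the tower's own index type `TLvl V`. [folklore] -/
abbrev TowerQ : Type := Module.DirectLimit (HKQ hHD hI hU h₃ hA V) (systemQ hHD hI hU h₃ hA V)

variable {V}

/-- `U_K → U`. [folklore] -/
abbrev ofQ (Γ : Level V) (hΓ : Γ.BelowConjThree) : levelQ hHD hI hU h₃ hA Γ hΓ →ₗ[ℚ] TowerQ hHD hI hU h₃ hA V :=
  Module.DirectLimit.of ℚ (TLvl V) (HKQ hHD hI hU h₃ hA V) (systemQ hHD hI hU h₃ hA V) (TLvl.mk Γ hΓ)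

/-- Compatibility with the transitions: `ofQ Γ' (restrictQ c) = ofQ Γ c`. [folklore] -/
theorem ofQ_restrictQ {Γ Γ' : Level V} (hle : Γ' ≤ Γ) (hΓ : Γ.BelowConjThree) (hΓ' : Γ'.BelowConjThree)
    (c : levelQ hHD hI hU h₃ hA Γ hΓ) :
    ofQ hHD hI hU h₃ hA Γ' hΓ' (restrictQ hHD hI hU h₃ hA hle hΓ hΓ' c) = ofQ hHD hI hU h₃ hA Γ hΓ c :=
  Module.DirectLimit.of_f (G := HKQ hHD hI hU h₃ hA V) (f := systemQ hHD hI hU h₃ hA V) (i := TLvl.mk Γ hΓ)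
    (j := TLvl.mk Γ' hΓ') (hij := TLvl.le_def.mpr hle) (x := c)

/-- Crossing a change (e.g. an equality) of levels in `U`: if `restrictQ x = y` then `ofQ x = ofQ y`. [folklore] -/
theorem ofQ_eq_of_restrictQ_eq {Γ Γ' : Level V} (hle : Γ' ≤ Γ) (hΓ : Γ.BelowConjThree) (hΓ' : Γ'.BelowConjThree)
    (x : levelQ hHD hI hU h₃ hA Γ hΓ) (y : levelQ hHD hI hU h₃ hA Γ' hΓ') (h : restrictQ hHD hI hU h₃ hA hle hΓ hΓ' x = y) :
    ofQ hHD hI hU h₃ hA Γ hΓ x = ofQ hHD hI hU h₃ hA Γ' hΓ' y := by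
  rw [← h, ofQ_restrictQ]

/-- **`ofQ Γ hΓ : U_K → U` is injective** (injective transitions in a directed system). [folklore] -/
theorem ofQ_injective (Γ : Level V) (hΓ : Γ.BelowConjThree) : Injective (ofQ hHD hI hU h₃ hA Γ hΓ) := by
  intro c d hcd
  have h0 : ofQ hHD hI hU h₃ hA Γ hΓ (c - d) = 0 := by rw [map_sub, hcd, sub_self]
  obtain ⟨j, hij, hj⟩ := Module.DirectLimit.of.zero_exact h0
  have hinj := restrictQ_injective hHD hI hU h₃ hA (TLvl.le_def.mp hij) hΓ j.2
  have hcd' : c - d = 0 := hinj (by rw [map_zero]; exact hj)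
  exact sub_eq_zero.mp hcd'

end Colimit

/-! ## §4 The complexification `ιT : ℂ ⊗_ℚ U →ₗ[ℂ] H` and its injectivity -/

section Complexification

variable (V)

/-- `Tower … V` as a `ℚ`-module by restriction of scalars along `ℚ → ℂ` (`Module.compHom`, the device of `TowerAlgebra`'s
`ℂ[U(V)(𝔸_f)]`-structure; instance search does not restrict scalars on the direct limit by itself). [folklore] -/
instance instModuleRatTower : Module ℚ (Tower hHD hI hU h₃ hA V) :=
  Module.compHom (Tower hHD hI hU h₃ hA V) (algebraMap ℚ ℂ)

/-- The two scalar actions on the tower are compatible. [folklore] -/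
instance instIsScalarTowerRatTower : IsScalarTower ℚ ℂ (Tower hHD hI hU h₃ hA V) :=
  ⟨fun q z x => show (q • z) • x = algebraMap ℚ ℂ q • (z • x) by rw [Algebra.smul_def, mul_smul]⟩

/-- Unfolding of the `ℚ`-action: `q • x = (q : ℂ) • x`. [folklore] -/
theorem rat_smul_def (q : ℚ) (x : Tower hHD hI hU h₃ hA V) : q • x = algebraMap ℚ ℂ q • x := rfl

variable {V}

/-- `U_K → H`, `c ↦ ofLevel (inclQ c)`, `ℚ`-linear. [folklore] -/
def jLevel (Γ : Level V) (hΓ : Γ.BelowConjThree) : levelQ hHD hI hU h₃ hA Γ hΓ →ₗ[ℚ] Tower hHD hI hU h₃ hA V where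
  toFun c := ofLevel hHD hI hU h₃ hA Γ hΓ (inclQ hHD hI hU h₃ hA Γ hΓ c)
  map_add' _ _ := by rw [map_add, map_add]
  map_smul' q c := by
    rw [map_smul, ← algebraMap_smul ℂ q (inclQ hHD hI hU h₃ hA Γ hΓ c), map_smul]
    rfl

/-- Unfolding. [folklore] -/
@[simp] theorem jLevel_apply (Γ : Level V) (hΓ : Γ.BelowConjThree) (c : levelQ hHD hI hU h₃ hA Γ hΓ) :
    jLevel hHD hI hU h₃ hA Γ hΓ c = ofLevel hHD hI hU h₃ hA Γ hΓ (inclQ hHD hI hU h₃ hA Γ hΓ c) := rfl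

variable (V)

/-- **`jQ : U → H`**, the `ℚ`-linear comparison of the rational tower with the tower (`DirectLimit.lift` of the `jLevel`). [folklore] -/
def jQ : TowerQ hHD hI hU h₃ hA V →ₗ[ℚ] Tower hHD hI hU h₃ hA V :=
  Module.DirectLimit.lift ℚ (TLvl V) (HKQ hHD hI hU h₃ hA V) (systemQ hHD hI hU h₃ hA V)
    (fun i => jLevel hHD hI hU h₃ hA i.1 i.2)
    (fun i j hij c => by
      show ofLevel hHD hI hU h₃ hA j.1 j.2 (inclQ hHD hI hU h₃ hA j.1 j.2 (restrictQ hHD hI hU h₃ hA (TLvl.le_def.mp hij) i.2 j.2 c)) =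
        ofLevel hHD hI hU h₃ hA i.1 i.2 (inclQ hHD hI hU h₃ hA i.1 i.2 c)
      rw [inclQ_restrictQ, ofLevel_restrictLevel])

variable {V}

/-- `jQ (ofQ c) = ofLevel (inclQ c)`. [folklore] -/
@[simp] theorem jQ_ofQ (Γ : Level V) (hΓ : Γ.BelowConjThree) (c : levelQ hHD hI hU h₃ hA Γ hΓ) :
    jQ hHD hI hU h₃ hA V (ofQ hHD hI hU h₃ hA Γ hΓ c) = ofLevel hHD hI hU h₃ hA Γ hΓ (inclQ hHD hI hU h₃ hA Γ hΓ c) :=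
  Module.DirectLimit.lift_of _ _ _

variable (V)

/-- **`ιT : ℂ ⊗_ℚ U →ₗ[ℂ] H`** — the complexification of the rational tower read in the tower (`liftBaseChange` of `jQ`): the field
`ι` of `Map43RationalData` at the pin, with `HB := Tower … V`. [folklore] -/
def ιT : ℂ ⊗[ℚ] TowerQ hHD hI hU h₃ hA V →ₗ[ℂ] Tower hHD hI hU h₃ hA V :=
  (jQ hHD hI hU h₃ hA V).liftBaseChange ℂ

variable {V}

/-- `ιT (z ⊗ u) = z • jQ u`. [folklore] -/
theorem ιT_tmul (z : ℂ) (u : TowerQ hHD hI hU h₃ hA V) : ιT hHD hI hU h₃ hA V (z ⊗ₜ[ℚ] u) = z • jQ hHD hI hU h₃ hA V u :=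
  LinearMap.liftBaseChange_tmul ℂ _ z u

/-- **`ιT (z ⊗ ofQ c) = z • ofLevel (inclQ c)`.** [folklore] -/
theorem ιT_tmul_ofQ (z : ℂ) (Γ : Level V) (hΓ : Γ.BelowConjThree) (c : levelQ hHD hI hU h₃ hA Γ hΓ) :
    ιT hHD hI hU h₃ hA V (z ⊗ₜ[ℚ] ofQ hHD hI hU h₃ hA Γ hΓ c) =
      z • ofLevel hHD hI hU h₃ hA Γ hΓ (inclQ hHD hI hU h₃ hA Γ hΓ c) := by
  rw [ιT_tmul, jQ_ofQ]

/-- **The levelwise complexification `ℂ ⊗_ℚ U_K →ₗ[ℂ] H_K`** (`liftBaseChange` of `inclQ`; `z ⊗ c ↦ z • inclQ c`). [folklore] -/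
def levelι (Γ : Level V) (hΓ : Γ.BelowConjThree) :
    ℂ ⊗[ℚ] levelQ hHD hI hU h₃ hA Γ hΓ →ₗ[ℂ] towerLevel hHD hI hU h₃ hA Γ hΓ :=
  (inclQ hHD hI hU h₃ hA Γ hΓ).liftBaseChange ℂ

/-- `levelι (z ⊗ c) = z • inclQ c`. [folklore] -/
theorem levelι_tmul (Γ : Level V) (hΓ : Γ.BelowConjThree) (z : ℂ) (c : levelQ hHD hI hU h₃ hA Γ hΓ) :
    levelι hHD hI hU h₃ hA Γ hΓ (z ⊗ₜ[ℚ] c) = z • inclQ hHD hI hU h₃ hA Γ hΓ c :=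
  LinearMap.liftBaseChange_tmul ℂ _ z c

/-- The levelwise complexification, read in `Π_h ℂ ⊗_ℚ H¹(P_{Γ_h}(ℂ); ℚ)`, is `piRightHom ∘ (subtype ⊗ ℂ)`. [folklore] -/
theorem subtype_levelι (Γ : Level V) (hΓ : Γ.BelowConjThree) (t : ℂ ⊗[ℚ] levelQ hHD hI hU h₃ hA Γ hΓ) :
    ((levelι hHD hI hU h₃ hA Γ hΓ t : towerLevel hHD hI hU h₃ hA Γ hΓ) : Π h : V.adelicFin, W hHD hI hU h₃ Γ hΓ h) =
      TensorProduct.piRightHom ℚ ℂ ℂ (WQ hHD hI hU h₃ Γ hΓ)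
        (((levelQ hHD hI hU h₃ hA Γ hΓ).subtype).baseChange ℂ t) := by
  induction t using TensorProduct.induction_on with
  | zero => simp only [map_zero, Submodule.coe_zero]
  | tmul z c =>
    funext h
    rw [levelι_tmul, coe_smul_inclQ_apply, LinearMap.baseChange_tmul, TensorProduct.piRightHom_tmul]
    rfl
  | add s t hs ht => simp only [map_add, Submodule.coe_add, hs, ht]

/-- **`ℂ ⊗_ℚ U_K → H_K` is injective** (`ℂ` is flat and free over `ℚ`: `baseChange_injective`, `piRightHom_injective_of_free`). [folklore] -/
theorem levelι_injective (Γ : Level V) (hΓ : Γ.BelowConjThree) : Injective (levelι hHD hI hU h₃ hA Γ hΓ) := by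
  intro s t hst
  have h := congrArg (fun x : towerLevel hHD hI hU h₃ hA Γ hΓ => (x : Π h : V.adelicFin, W hHD hI hU h₃ Γ hΓ h)) hst
  simp only [subtype_levelι] at h
  exact LinearMap.baseChange_injective ℂ _ (Submodule.subtype_injective _)
    (TensorProduct.piRightHom_injective_of_free ℚ ℂ ℂ (WQ hHD hI hU h₃ Γ hΓ) h)

/-- `ιT` on the image of one level: `ιT ((ofQ Γ) ⊗ ℂ) s) = ofLevel Γ (levelι s)`. [folklore] -/
theorem ιT_lTensor_ofQ (Γ : Level V) (hΓ : Γ.BelowConjThree) (s : ℂ ⊗[ℚ] levelQ hHD hI hU h₃ hA Γ hΓ) :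
    ιT hHD hI hU h₃ hA V ((ofQ hHD hI hU h₃ hA Γ hΓ).lTensor ℂ s) =
      ofLevel hHD hI hU h₃ hA Γ hΓ (levelι hHD hI hU h₃ hA Γ hΓ s) := by
  induction s using TensorProduct.induction_on with
  | zero => simp only [map_zero]
  | tmul z c => rw [LinearMap.lTensor_tmul, ιT_tmul_ofQ, levelι_tmul, map_smul]
  | add s t hs ht => simp only [map_add, hs, ht]

variable (V)

/-- **`ιT : ℂ ⊗_ℚ U → H` is INJECTIVE** — the field `ι_injective` of `Map43RationalData` at the pin: every element of `ℂ ⊗_ℚ colim_K U_K`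
comes from one level (`exists_lTensor_of`), where `ιT` is `ofLevel ∘ levelι`, both injective (`ofLevel_injective`, `levelι_injective`).
[folklore] -/
theorem ιT_injective : Injective (ιT hHD hI hU h₃ hA V) := by
  rw [injective_iff_map_eq_zero]
  intro t ht
  obtain ⟨i, s, rfl⟩ := Module.DirectLimit.exists_lTensor_of (HKQ hHD hI hU h₃ hA V) (systemQ hHD hI hU h₃ hA V) ℂ t
  have h1 : ofLevel hHD hI hU h₃ hA i.1 i.2 (levelι hHD hI hU h₃ hA i.1 i.2 s) = 0 := by
    rw [← ιT_lTensor_ofQ]; exact ht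
  have h2 : levelι hHD hI hU h₃ hA i.1 i.2 s = 0 :=
    ofLevel_injective hHD hI hU h₃ hA i.1 i.2 (by rw [h1, map_zero])
  have h3 : s = 0 := levelι_injective hHD hI hU h₃ hA i.1 i.2 (by rw [h2, map_zero])
  rw [h3, map_zero]

end Complexification

end TowerRational

end Summit.HodgeConjecture.CorCM.D2Bridge

end
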